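import Mathlib.Data.Fin.VecNotation
import Mathlib.Algebra.BigOperators.Fin
import Mathlib.Topology.Algebra.Order.Field
import Mathlib.Analysis.SpecialFunctions.Pow.Real
import Literature.MathematicalPhysics.QuantumFieldTheory.Volkov2020.OnShellDenominatorCircuit
import HarnessLib

/-!
# Volkov 2020 (NPB 961, 115232), APPENDIX «An example that demonstrates the exactness of the estimation» — the PARAMETRIC half in the kernel: on the crossed two-loop graph of Fig. 2 along the printed two-scale ray z = (Λδ, δ², δ², δ², ~1, Λδ²) one has D ∼ (Λ+3)δ², W ∼ −m²(9/(Λ+3) + Λ²)δ², B₁₂ = B₁₃ = (Λ+1)δ², B₁₄ = −2δ², B₂₃ ∼ B₂₄ = B₃₄ ∼ 1, min z ≍ δ², z₁⋯z₆ ≍ δ⁹, so the (1.9) majorant (min z)^{1/2}/(z₁⋯z₆) ≍ δ⁻⁸ and each of the three |P| = 1 factors B_{l₁l₂}/(D³W) is ∼ −δ⁻⁸/(m²(Λ+3)²(Λ³+3Λ²+9)); with any projector values of non-zero sum the dominant terms are ≍ the majorant — PROVED, W being the tree's own `PathSkeleton.W` (eq. (2.4), Thomson form) evaluated in closed form by an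 explicit Kirchhoff current distribution

independent recomputation; certified where stated, statistical where stated; no new-physics claim.

CITATION HEADER (venture `QEDPrecision`, cell `pub-qed`, track TROPICAL seat V3b = `pub-qed-trop-v3-lit-2` gen 11; VALUE-FREE: polynomial identities and
limits for ONE printed two-loop example — no integrand of ours, nothing per word, nothing of X352). Serves `tropical/view/V3-VOLKOV-DEGREES.md` §B B.1 /
B.17 (1) («the ½ is sharp on a TWO-scale approach … the Appendix example = word abab, external photon on the middle line»), B.33's last row («Appendix ✗»)
and the V2 seats' «analytic calibration ray for any exponent fitter» (INBOX l.16431).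

Source. [Volkov2020] S. Volkov, «Infrared and ultraviolet power counting on the mass shell in quantum electrodynamics», Nucl. Phys. B 961 (2020) 115232
= arXiv:1912.04885v4 (e-print `iclos_arxiv.tex` held by the cell: `pub-qed-trop-v3-lit-2/sources/arxiv-1912.04885/`, Appendix = tex l.619–682; journal
p.18–19, Fig. 2 = `example_unimprov.eps`), VERBATIM:
* §1 (journal p.5; tex l.116–119): «|I′(z)| ≤ C·(min(z₁,…,z_L))^{1/2}/(z₁·…·z_L). (1.9) … The power 1/2 in (1.9) is unimprovable (in contrast to the known
  case with fixed ε>0 where all degrees are integer, and 1/2 can be replaced with 1); see an example in Appendix.»; §4 (p.18; l.611): «The power 1/2 in the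
  inequality is not improvable (see Appendix)».
* §2.2.1 (p.8–9; l.213–232): «D(z) = Σ_T ∏_{l∈E(G)∖T} z_l, the summation goes over all 1-trees in G» · «B_{l₁l₂}(z) = Σ_{T′} c(T′) ∏_{l∈E(G)∖T′} z_l, (2.3)
  the summation goes over all trees with cycle containing l₁ and l₂ on the cycle, c(T′) = 1 if the direction of l₁ and l₂ on the cycle is the same,
  c(T′) = −1 if the direction is opposite» · «each pair {l₁,l₂} ∈ P gives the global multiplier B_{l₁l₂}(z)/D(z)», «The global multiplier 1/D(z)² starts
  the product»; §2.2.2 eq. (2.4) (p.10; l.261–264): «W(z) = m²(Z(z) − Z₀(z)), where Z(z) is the resistance between the vertexes that are incident to the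
  external lepton lines of the electric circuit with topology G, line resistances z_l; Z₀(z) = Σ_{l∈Lept(E(G))} z_l».
* APPENDIX (p.18–19; l.619–682): «Let us consider an example demonstrating that the power 1/2 in (1.9) is not improvable. Let us take the two-loop Feynman
  graph from Fig. 2. For this graph we will use the following values of Feynman parameters: z₁ = Λδ, z₂ = z₃ = z₄ = δ², z₅ ∼ 1, z₆ = Λδ², where δ → 0,
  for the constant Λ we take some sufficiently big value. We will write f(δ) ∼ g(δ), if lim_{δ→0} f(δ)/g(δ) = 1. Also, we will write f(δ) ≍ g(δ), if
  0 < C₁ ≤ |f(δ)/g(δ)| < C₂ for all 0 < δ < δ₀, where δ₀ > 0. We have D ∼ (Λ+3)δ², W ∼ −m²(9/(Λ+3) + Λ²)δ², B₁₂ = B₁₃ = (Λ+1)δ², B₁₄ = −2δ²,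
  B₂₃ = B₂₄ = B₃₄ ∼ 1, min(z₁,…,z₆) ≍ δ², z₁…z₆ ≍ δ⁹. We have terms that potentially can have the asymptotics (min(z₁,…,z₆))^{1/2}/(z₁…z₆) ≍ 1/δ⁸ for
  P = {∅}, P = {{2,3}}, P = {{2,4}}, P = {{3,4}} (we have M = 2 − |P| in (1.8)). The most difficult task is to demonstrate that the asymptotics is not
  cancelled in some way. If we take a sufficiently big Λ, then the “naive” asymptotics for the terms corresponding to |P| = 1 will dominate over the
  other terms asymptotics. Moreover, in the multipliers m + Q̂_l/D for l = 1,2,3,4 the part m + p̂_j will dominate, where j = 1 for l = 1,2, j = 2 for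
  l = 3,4. The contributions of these dominated terms are B₂₃/(D³W)·𝒫[F₂₃], B₂₄/(D³W)·𝒫[F₂₄], B₃₄/(D³W)·𝒫[F₃₄] for P = {{2,3}}, P = {{2,4}}, P = {{3,4}}
  correspondingly … 𝒫[F₂₃] = 16m², 𝒫[F₂₄] = −8m², 𝒫[F₃₄] = 0. Since 𝒫[F₂₃+F₂₄+F₃₄] = 8m² ≠ 0, B₂₃ = B₂₄ = B₃₄, these asymptotically dominated
  terms are not cancelled.»

THE ONE MODELLING STEP (flagged). Fig. 2 is a drawing; its line labels are read here as: lepton path v₀–v₁–v₂–v₃–v₄ with the external photon at v₂,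
lepton lines 1 = v₀v₁, 2 = v₁v₂, 3 = v₂v₃, 4 = v₃v₄ (directed along the path; «j = 1 for l = 1,2, j = 2 for l = 3,4» = the incoming momentum flows in
lines 1, 2, the outgoing one in 3, 4), photon 5 = v₀v₃ (over the lepton lines 1, 2, 3), photon 6 = v₁v₄ (over 2, 3, 4) — the crossed («abab») two-loop
vertex graph. This reading reproduces EVERY printed parametric statement of the Appendix (this file), and it is the only one that does up to the
mirror symmetry of the drawing: «D ∼ (Λ+3)δ²» forces the Λδ-line to lie under exactly one photon, the one with z ∼ 1 (exchanging the two photons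
gives D ∼ Λδ·z₅), and «B₁₃ = (Λ+1)δ², B₁₄ = −2δ²» fix the order of the lines 3, 4. Internally the lines are indexed 0,…,5 = printed 1,…,6 (`Fin 6`); the circuit
is the tree's `PathSkeleton` (`CapturedPhotonBound`) `crossed` = {N := 4, ph := {(0,3),(1,4)}, ext := 2}. For THIS two-loop graph «T runs over all
1-trees» = over the complements of the 2-sets of lines whose removal keeps the five vertices connected, and «trees with cycle» = the complements of
single lines (every such complement is connected here), the cycle being its non-bridges; the sign c(T′) is computed by walking the cycle in the
direction of l₁ [folklore: a set of |V|−1 lines on |V| vertices is a spanning tree iff it is connected; a connected set of |V| lines has exactly one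
cycle, formed by its non-bridges]. These finite searches are Boolean functions evaluated by `decide` (§1); the resulting D and B_{l₁l₂} are then
explicit polynomials (§2). z₅ ∼ 1 is realised as z₅ = 1 − Λδ − 3δ² − Λδ² (the δ-function of (1.7) puts z on the simplex Σz = 1), under which all six
parameters are positive for 0 < δ < 1/(2Λ+5).

WHAT THE KERNEL CERTIFIES (`namespace …Volkov2020.AppendixExample`).
§1–§2 `treeCompls_eq` (the twelve 1-trees), `cycleTerms_eq_*` (the trees with cycle through each lepton pair, with signs), **`D_eq`**: D = z₁z₂ + z₁z₃ +
z₁z₄ + z₁z₆ + z₂z₄ + z₂z₅ + z₂z₆ + z₃z₄ + z₃z₅ + z₃z₆ + z₄z₅ + z₅z₆; **`B12_eq`** … **`B34_eq`**: B₁₂ = B₁₃ = z₄ + z₆, B₁₄ = −(z₂ + z₃), B₂₃ = z₁ + z₄ + z₅ +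
z₆, B₂₄ = B₃₄ = z₁ + z₅ (printed indices).
§3 **`W_eq`**: for all positive z, `crossed.W m z = −m²·N(z)/D(z)` with N = a²(z₆ + b) − 2abc + b²(z₅ + a), a = z₁+z₂+z₃, b = z₂+z₃+z₄, c = z₂+z₃ — from an
EXPLICIT solution `tKir` of Kirchhoff's voltage law on `crossed` (`kvl`) and the tree's `PathSkeleton.effRes_eq_voltage_of_KVL` (Thomson ⇒ Z = voltage drop);
the 1-tree polynomial D is exactly the determinant of the two-chord Kirchhoff system (`D_eq_det`).
§4 on the ray (`ray`, `ray_sum` Σz = 1, `ray_pos`): **`D_sim`** D ∼ (Λ+3)δ² (indeed `D_ray`: D = (Λ+3)δ² − (Λ²+4Λ+7)δ⁴ exactly, = δ²·`pD`); **`W_sim`**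
W ∼ −m²(9/(Λ+3)+Λ²)δ² (`wNum_ray`: N = (Λ³+3Λ²+9)δ⁴ + 4Λ²δ⁵ − (5Λ+21)δ⁶ = δ⁴·`pN`); **`B12_ray`**, **`B13_ray`** = (Λ+1)δ², **`B14_ray`** = −2δ², **`B23_sim`**, **`B24_sim`**, **`B34_sim`** ∼ 1 and
`B24_eq_B34`; **`min_ray`** min z = δ² = z₂ (Λ ≥ 1, 0 < δ < 1/(2Λ+5)) hence `min_comp` ≍ δ²; **`prod_ray`**, `prod_comp` z₁⋯z₆ = Λ²δ⁹·z₅ ≍ δ⁹;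
**`majorant_comp`** (min z)^{1/2}/(z₁⋯z₆) ≍ δ⁻⁸ — with the printed meaning of ∼ (`Sim`: f/g → 1 as δ → 0⁺) and of ≍ (`Comp`: 0 < C₁ ≤ |f/g| < C₂ on (0, δ₀)).
§5 **`pairFactor_tendsto`**: δ⁸·B_{l₁l₂}/(D³W) → −1/(m²(Λ+3)²(Λ³+3Λ²+9)) ≠ 0 for each of {2,3}, {2,4}, {3,4} (so each factor ≍ δ⁻⁸, the majorant's order);
**`dominant_over_majorant_tendsto`**: for ANY reals π₂₃, π₂₄, π₃₄ (the projector values 𝒫[F_{l₁l₂}]), (Σ B_{l₁l₂}/(D³W)·π_{l₁l₂}) / ((min z)^{1/2}/∏z) →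
−(π₂₃+π₂₄+π₃₄)·Λ²/(m²(Λ+3)²(Λ³+3Λ²+9)), non-zero iff π₂₃+π₂₄+π₃₄ ≠ 0 (`dominant_limit_ne_zero_iff`); with the printed triple (16m², −8m², 0) the limit is
−8Λ²/((Λ+3)²(Λ³+3Λ²+9)) ≠ 0 (`dominant_over_majorant_printed`): along this ray the |P| = 1 terms singled out by the Appendix are of the exact order of the
(1.9) majorant, i.e. the power ½ is attained — GIVEN the printed projector values and the printed dominance of these terms.
NOT claimed: the γ-matrix computations F₂₃, F₂₄, F₃₄ and the projector values 𝒫[F] (the Appendix's «calculation with the help of a computer»; a separate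
certificate); the dominance of the |P| = 1, (m + p̂_j)-parts over the remaining terms («If we take a sufficiently big Λ …»); the §2.2 derivation that the
integrand has the form K·Σ[𝒫Π]Y/W^{L+u}; the identification of Fig. 2's labels beyond the check stated above.
-/

namespace Literature.MathematicalPhysics.QuantumFieldTheory.Volkov2020

open Finset Filter Topology

namespace AppendixExample

/-! ## §1 The graph of Fig. 2 (Appendix): lines, 1-trees, trees with cycle and their signs — finite searches by `decide` -/

/-- The six internal lines of the Appendix graph as (tail, head) on the vertices v₀,…,v₄ of the lepton path: lepton lines 0,…,3 (printed 1,…,4) = v_k → v_{k+1},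
photon 4 (printed 5) = v₀v₃, photon 5 (printed 6) = v₁v₄ (the modelling step of the header). [cite: Volkov2020, Appendix Fig. 2 (journal p.19; tex l.623–629)] -/
def edge : Fin 6 → Fin 5 × Fin 5 := ![(0, 1), (1, 2), (2, 3), (3, 4), (0, 3), (1, 4)]

/-- One round of undirected reachability propagation along the lines in `T`. [folklore] -/
def relax (T : List (Fin 6)) (r : Fin 5 → Bool) : Fin 5 → Bool := fun v =>
  r v || T.any fun e => (r (edge e).1 && decide ((edge e).2 = v)) || (r (edge e).2 && decide ((edge e).1 = v))

/-- The vertices reachable from `u` through the lines in `T` (five rounds suffice on five vertices). [folklore] -/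
def reachFrom (T : List (Fin 6)) (u : Fin 5) : Fin 5 → Bool :=
  relax T (relax T (relax T (relax T (relax T fun v => decide (v = u)))))

/-- `T` connects all five vertices. [folklore] -/
def connects (T : List (Fin 6)) : Bool := (List.finRange 5).all fun v => reachFrom T 0 v

/-- All lines except those in `S` («E(G) ∖ …»). [cite: Volkov2020, §2.2.1 (journal p.8)] -/
def without (S : List (Fin 6)) : List (Fin 6) := (List.finRange 6).filter fun e => !(S.contains e)

/-- `{a, b}` (a < b) is the complement E(G) ∖ T of a 1-tree T: the remaining four lines connect the five vertices (⇔ form a spanning tree).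
[cite: Volkov2020, §2.1 «1-tree» (journal p.7; tex l.150–155)] -/
def isTreeCompl (a b : Fin 6) : Bool := decide (a < b) && connects (without [a, b])

/-- The list of complements {a, b} of the 1-trees of the graph — the index set of «D(z) = Σ_T ∏_{l∈E(G)∖T} z_l» for this two-loop graph.
[cite: Volkov2020, §2.2.1 D(z) (journal p.8; tex l.213–218)] -/
def treeCompls : List (Fin 6 × Fin 6) :=
  ((List.finRange 6).flatMap fun a => (List.finRange 6).map fun b => (a, b)).filter fun p => isTreeCompl p.1 p.2

/-- **The twelve 1-trees of Fig. 2's graph**, by their complements (0-based line indices). [cite: Volkov2020, §2.1, §2.2.1 (journal p.7–8)] -/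
theorem treeCompls_eq : treeCompls =
    [(0,1), (0,2), (0,3), (0,5), (1,3), (1,4), (1,5), (2,3), (2,4), (2,5), (3,4), (4,5)] := by decide

/-- Graph distance from `u` to `v` inside the line set `T` (6 = not reached within four steps). [folklore] -/
def distIn (T : List (Fin 6)) (u v : Fin 5) : ℕ :=
  let r0 : Fin 5 → Bool := fun w => decide (w = u)
  let rs := [r0, relax T r0, relax T (relax T r0), relax T (relax T (relax T r0)), relax T (relax T (relax T (relax T r0)))]
  match rs.findIdx? (fun r => r v) with
  | some n => n
  | none => 6

/-- In the tree with cycle T′ = E(G) ∖ {e} (five lines on five vertices, connected for every e here), the line f ≠ e lies ON THE CYCLE iff removing it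
as well keeps the vertices connected (the cycle = the non-bridges). [cite: Volkov2020, §2.1 «tree with cycle» (journal p.7; tex l.153–155)] -/
def onCycle (e f : Fin 6) : Bool := decide (f ≠ e) && connects (without [e, f])

/-- «c(T′) = 1 if the direction of l₁ and l₂ on the cycle is the same»: walk the cycle of E(G) ∖ {e} in the direction of l₁ = (u₁ → v₁), i.e. along the
path (cycle ∖ {l₁}) from v₁ back to u₁; l₂ = (u₂ → v₂) points the same way iff u₂ is reached before v₂. [cite: Volkov2020, eq. (2.3) (journal p.9; tex l.226–232)] -/
def sameDir (e l₁ l₂ : Fin 6) : Bool :=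
  decide (distIn (without [e, l₁]) (edge l₁).2 (edge l₂).1 < distIn (without [e, l₁]) (edge l₁).2 (edge l₂).2)

/-- The signed index set of «B_{l₁l₂}(z) = Σ_{T′} c(T′) ∏_{l∉T′} z_l»: the pairs (e, c(T′)) over the trees with cycle T′ = E(G) ∖ {e} whose cycle contains
l₁ and l₂. [cite: Volkov2020, eq. (2.3) (journal p.9; tex l.226–232)] -/
def cycleTerms (l₁ l₂ : Fin 6) : List (Fin 6 × ℤ) :=
  ((List.finRange 6).filter fun e => onCycle e l₁ && onCycle e l₂).map fun e => (e, if sameDir e l₁ l₂ then 1 else -1)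

/-- Trees with cycle through the lepton lines 1, 2 (printed): remove 4 or 6; both with c = +1. [cite: Volkov2020, eq. (2.3), Appendix «B₁₂» (journal p.9, p.19)] -/
theorem cycleTerms_eq_01 : cycleTerms 0 1 = [(3, 1), (5, 1)] := by decide
/-- Through 1, 3: remove 4 or 6; c = +1. [cite: Volkov2020, eq. (2.3), Appendix «B₁₃» (journal p.9, p.19)] -/
theorem cycleTerms_eq_02 : cycleTerms 0 2 = [(3, 1), (5, 1)] := by decide
/-- Through 1, 4: remove 2 or 3; the cycle 1–6–4–5 traverses 1 and 4 oppositely, c = −1. [cite: Volkov2020, eq. (2.3), Appendix «B₁₄» (journal p.9, p.19)] -/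
theorem cycleTerms_eq_03 : cycleTerms 0 3 = [(1, -1), (2, -1)] := by decide
/-- Through 2, 3: remove 1, 4, 5 or 6; c = +1. [cite: Volkov2020, eq. (2.3), Appendix «B₂₃» (journal p.9, p.19)] -/
theorem cycleTerms_eq_12 : cycleTerms 1 2 = [(0, 1), (3, 1), (4, 1), (5, 1)] := by decide
/-- Through 2, 4: remove 1 or 5; c = +1. [cite: Volkov2020, eq. (2.3), Appendix «B₂₄» (journal p.9, p.19)] -/
theorem cycleTerms_eq_13 : cycleTerms 1 3 = [(0, 1), (4, 1)] := by decide
/-- Through 3, 4: remove 1 or 5; c = +1. [cite: Volkov2020, eq. (2.3), Appendix «B₃₄» (journal p.9, p.19)] -/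
theorem cycleTerms_eq_23 : cycleTerms 2 3 = [(0, 1), (4, 1)] := by decide

/-- Every single-line removal leaves the five vertices connected (so E(G) ∖ {e} is a tree with cycle for each e, as used by `cycleTerms`), and the
vertex pairs of `edge` are those of the skeleton `crossed` below. [cite: Volkov2020, §2.1 (journal p.7)] -/
theorem connects_without_single : ∀ e : Fin 6, connects (without [e]) = true := by decide

/-- **Fig. 2's graph as a lepton-path skeleton** (`PathSkeleton` of `CapturedPhotonBound`): four lepton lines 0,…,3 on the vertices 0,…,4, photons
(0,3) and (1,4), external photon at vertex 2. [cite: Volkov2020, Appendix Fig. 2 (journal p.19); §2.1 (p.7)] -/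
def crossed : PathSkeleton where
  N := 4
  ph := {(0, 3), (1, 4)}
  ext := 2
  lt_of_mem := by decide
  le_of_mem := by decide
  ext_le := by decide
  inj := by
    intro p hp q hq w hpw hqw
    simp only [Finset.mem_insert, Finset.mem_singleton] at hp hq
    unfold IsEnd at hpw hqw
    rcases hp with rfl | rfl <;> rcases hq with rfl | rfl <;> first | rfl | (simp only at hpw hqw; omega)
  ext_free := by decide

/-- The photon set of `crossed`. [cite: Volkov2020, Appendix Fig. 2 (journal p.19)] -/
theorem crossed_ph : crossed.ph = {(0, 3), (1, 4)} := rfl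

/-- Fig. 2's graph has no lepton self-energy block (it is in the scope of Theorem 3.1: every proper vertex interval avoiding the external vertex is left
by a photon). [cite: Volkov2020, §2.1 restriction «ω(s) < 0» (journal p.7); Theorem 3.1 (p.17)] -/
theorem crossed_noSelfEnergyBlock : crossed.NoSelfEnergyBlock := by
  intro a b hab hb hext
  change b ≤ 4 at hb
  change ¬ (a ≤ 2 ∧ 2 ≤ b) at hext
  by_cases h : b ≤ 1
  · refine ⟨(0, 3), by decide, ?_⟩
    change (a ≤ 0 ∧ 0 ≤ b) ∧ ¬ (a ≤ 3 ∧ 3 ≤ b) ∨ ¬ (a ≤ 0 ∧ 0 ≤ b) ∧ (a ≤ 3 ∧ 3 ≤ b)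
    omega
  · refine ⟨(1, 4), by decide, ?_⟩
    change (a ≤ 1 ∧ 1 ≤ b) ∧ ¬ (a ≤ 4 ∧ 4 ≤ b) ∨ ¬ (a ≤ 1 ∧ 1 ≤ b) ∧ (a ≤ 4 ∧ 4 ≤ b)
    omega

/-! ## §2 D(z) and B_{l₁l₂}(z) of the Appendix graph, as printed, in closed form -/

/-- **D(z) AS PRINTED** for Fig. 2's graph: Σ over the 1-trees T of ∏_{l∉T} z_l = Σ over `treeCompls` of z_a z_b.
[cite: Volkov2020, §2.2.1 (journal p.8; tex l.213–218)] -/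
def D (z : Fin 6 → ℝ) : ℝ := (treeCompls.map fun p => z p.1 * z p.2).sum

/-- **B_{l₁l₂}(z) AS PRINTED** for Fig. 2's graph (0-based line indices): Σ over the trees with cycle through l₁, l₂ of c(T′)·z_e, e the removed line.
[cite: Volkov2020, eq. (2.3) (journal p.9; tex l.226–232)] -/
def B (l₁ l₂ : Fin 6) (z : Fin 6 → ℝ) : ℝ := ((cycleTerms l₁ l₂).map fun p => (p.2 : ℝ) * z p.1).sum

variable (z : Fin 6 → ℝ)

/-- **D in closed form** (printed indices): D = z₁z₂ + z₁z₃ + z₁z₄ + z₁z₆ + z₂z₄ + z₂z₅ + z₂z₆ + z₃z₄ + z₃z₅ + z₃z₆ + z₄z₅ + z₅z₆.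
[cite: Volkov2020, §2.2.1 D(z), Appendix (journal p.8, p.19)] -/
theorem D_eq : D z = z 0 * z 1 + z 0 * z 2 + z 0 * z 3 + z 0 * z 5 + z 1 * z 3 + z 1 * z 4 + z 1 * z 5 +
    z 2 * z 3 + z 2 * z 4 + z 2 * z 5 + z 3 * z 4 + z 4 * z 5 := by
  simp only [D, treeCompls_eq, List.map_cons, List.map_nil, List.sum_cons, List.sum_nil]
  ring

/-- **B₁₂ = z₄ + z₆** (printed indices; here `B 0 1 z = z 3 + z 5`). [cite: Volkov2020, eq. (2.3), Appendix (journal p.9, p.19)] -/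
theorem B12_eq : B 0 1 z = z 3 + z 5 := by
  simp only [B, cycleTerms_eq_01, List.map_cons, List.map_nil, List.sum_cons, List.sum_nil]; push_cast; ring

/-- **B₁₃ = z₄ + z₆**. [cite: Volkov2020, eq. (2.3), Appendix (journal p.9, p.19)] -/
theorem B13_eq : B 0 2 z = z 3 + z 5 := by
  simp only [B, cycleTerms_eq_02, List.map_cons, List.map_nil, List.sum_cons, List.sum_nil]; push_cast; ring

/-- **B₁₄ = −(z₂ + z₃)** (opposite orientation on the cycle 1–6–4–5). [cite: Volkov2020, eq. (2.3), Appendix (journal p.9, p.19)] -/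
theorem B14_eq : B 0 3 z = -(z 1 + z 2) := by
  simp only [B, cycleTerms_eq_03, List.map_cons, List.map_nil, List.sum_cons, List.sum_nil]; push_cast; ring

/-- **B₂₃ = z₁ + z₄ + z₅ + z₆**. [cite: Volkov2020, eq. (2.3), Appendix (journal p.9, p.19)] -/
theorem B23_eq : B 1 2 z = z 0 + z 3 + z 4 + z 5 := by
  simp only [B, cycleTerms_eq_12, List.map_cons, List.map_nil, List.sum_cons, List.sum_nil]; push_cast; ring

/-- **B₂₄ = z₁ + z₅**. [cite: Volkov2020, eq. (2.3), Appendix (journal p.9, p.19)] -/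
theorem B24_eq : B 1 3 z = z 0 + z 4 := by
  simp only [B, cycleTerms_eq_13, List.map_cons, List.map_nil, List.sum_cons, List.sum_nil]; push_cast; ring

/-- **B₃₄ = z₁ + z₅**. [cite: Volkov2020, eq. (2.3), Appendix (journal p.9, p.19)] -/
theorem B34_eq : B 2 3 z = z 0 + z 4 := by
  simp only [B, cycleTerms_eq_23, List.map_cons, List.map_nil, List.sum_cons, List.sum_nil]; push_cast; ring

/-- «B₂₄ = B₃₄» holds identically (not only asymptotically). [cite: Volkov2020, Appendix (journal p.19; tex l.639)] -/
theorem B24_eq_B34 : B 1 3 z = B 2 3 z := by rw [B24_eq, B34_eq]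

variable {z} in
/-- D > 0 for positive parameters (a sum of monomials). [cite: Volkov2020, §2.2.1 (journal p.8)] -/
theorem D_pos (hz : ∀ i, 0 < z i) : 0 < D z := by
  rw [D_eq]
  have := hz 0; have := hz 1; have := hz 2; have := hz 3; have := hz 4; have := hz 5
  positivity

/-! ## §3 W(z) = m²(Z − Z₀) on `crossed`, in closed form from an explicit Kirchhoff current distribution -/

/-- Lepton resistances of `crossed` from z (lines 0,…,3; junk value z₃ beyond, positive with z). [cite: Volkov2020, eq. (2.4) (journal p.10)] -/
def zl : ℕ → ℝ := fun k => if k = 0 then z 0 else if k = 1 then z 1 else if k = 2 then z 2 else z 3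

/-- Photon resistances of `crossed` from z (photon (0,3) ↦ z₅, (1,4) ↦ z₆ printed; junk value z₆ elsewhere). [cite: Volkov2020, eq. (2.4) (journal p.10)] -/
def zγ : ℕ × ℕ → ℝ := fun i => if i = (0, 3) then z 4 else z 5

/-- The numerator N(z) of Z₀ − Z = N/D: a²(z₆ + b) − 2abc + b²(z₅ + a) with a = z₁+z₂+z₃ (= z″₅), b = z₂+z₃+z₄ (= z″₆), c = z₂+z₃ (printed indices).
[cite: Volkov2020, eq. (2.4); proof of Lemma 3.4 «z″_i» (journal p.10, p.12)] -/
def wNum : ℝ :=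
  (z 0 + z 1 + z 2) ^ 2 * (z 5 + (z 1 + z 2 + z 3)) - 2 * (z 0 + z 1 + z 2) * (z 1 + z 2 + z 3) * (z 1 + z 2) +
    (z 1 + z 2 + z 3) ^ 2 * (z 4 + (z 0 + z 1 + z 2))

/-- The Kirchhoff chord currents of `crossed` at unit external current (Cramer's rule for the 2 × 2 mesh system; t = 0 off the two photons).
[cite: Volkov2020, §2.2.1 «electric circuit analogy» (journal p.9; tex l.237)] -/
noncomputable def tKir : ℕ × ℕ → ℝ := fun i =>
  if i = (0, 3) then ((z 0 + z 1 + z 2) * (z 5 + (z 1 + z 2 + z 3)) - (z 1 + z 2) * (z 1 + z 2 + z 3)) / D z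
  else if i = (1, 4) then ((z 1 + z 2 + z 3) * (z 4 + (z 0 + z 1 + z 2)) - (z 1 + z 2) * (z 0 + z 1 + z 2)) / D z
  else 0

/-- **D is the determinant of the mesh (chord) system**: D = (z₅ + a)(z₆ + b) − c². [folklore: the mesh-impedance determinant of a circuit equals its
spanning-tree polynomial in the impedances] [cite: Volkov2020, §2.2.1 (journal p.8–9)] -/
theorem D_eq_det : D z = (z 4 + (z 0 + z 1 + z 2)) * (z 5 + (z 1 + z 2 + z 3)) - (z 1 + z 2) ^ 2 := by
  rw [D_eq]; ring

variable {z}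

/-- Positivity of the lepton resistances. [cite: Volkov2020, §3.1 (journal p.10)] -/
theorem zl_pos (hz : ∀ i, 0 < z i) (k : ℕ) : 0 < zl z k := by
  unfold zl; split_ifs <;> exact hz _

/-- Positivity of the photon resistances. [cite: Volkov2020, §3.1 (journal p.10)] -/
theorem zγ_pos (hz : ∀ i, 0 < z i) (i : ℕ × ℕ) : 0 < zγ z i := by
  unfold zγ; split_ifs <;> exact hz _

/-- The photons over each lepton line of `crossed`: over 0 only (0,3); over 1 and 2 both; over 3 only (1,4). [cite: Volkov2020, §2.1 LPath (journal p.7)] -/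
theorem over_eq : crossed.over 0 = {(0, 3)} ∧ crossed.over 1 = {(0, 3), (1, 4)} ∧ crossed.over 2 = {(0, 3), (1, 4)} ∧
    crossed.over 3 = {(1, 4)} := by
  refine ⟨?_, ?_, ?_, ?_⟩ <;> decide

/-- The lepton-line currents of a chord vector t on `crossed`: 1 − t₅, 1 − t₅ − t₆, 1 − t₅ − t₆, 1 − t₆. [cite: Volkov2020, §2.2.1 (journal p.9)] -/
theorem lineCurrent_eq (t : ℕ × ℕ → ℝ) :
    crossed.lineCurrent t 0 = 1 - t (0, 3) ∧ crossed.lineCurrent t 1 = 1 - (t (0, 3) + t (1, 4)) ∧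
      crossed.lineCurrent t 2 = 1 - (t (0, 3) + t (1, 4)) ∧ crossed.lineCurrent t 3 = 1 - t (1, 4) := by
  obtain ⟨h0, h1, h2, h3⟩ := over_eq
  unfold PathSkeleton.lineCurrent
  rw [h0, h1, h2, h3, Finset.sum_singleton, Finset.sum_singleton, Finset.sum_pair (by decide)]
  exact ⟨rfl, rfl, rfl, rfl⟩

/-- Σ_{k ∈ Ico 0 3} unrolled. [folklore] -/
private theorem sum_Ico_03 (f : ℕ → ℝ) : ∑ k ∈ Finset.Ico 0 3, f k = f 0 + f 1 + f 2 := by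
  rw [show Finset.Ico 0 3 = {0, 1, 2} by decide, Finset.sum_insert (by decide), Finset.sum_insert (by decide), Finset.sum_singleton]
  ring

/-- Σ_{k ∈ Ico 1 4} unrolled. [folklore] -/
private theorem sum_Ico_14 (f : ℕ → ℝ) : ∑ k ∈ Finset.Ico 1 4, f k = f 1 + f 2 + f 3 := by
  rw [show Finset.Ico 1 4 = {1, 2, 3} by decide, Finset.sum_insert (by decide), Finset.sum_insert (by decide), Finset.sum_singleton]
  ring

/-- Σ_{k ∈ range 4} unrolled. [folklore] -/
private theorem sum_range_4 (f : ℕ → ℝ) : ∑ k ∈ Finset.range 4, f k = f 0 + f 1 + f 2 + f 3 := by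
  simp only [Finset.sum_range_succ, Finset.sum_range_zero]
  ring

/-- **`tKir` obeys Kirchhoff's voltage law on `crossed`** (it is the physical current distribution at unit external current).
[cite: Volkov2020, §2.2.1 «electric circuit analogy» (journal p.9; tex l.237)] -/
theorem kvl (hz : ∀ i, 0 < z i) : crossed.KVL (zl z) (zγ z) (tKir z) := by
  have hD : D z ≠ 0 := (D_pos hz).ne'
  obtain ⟨h0, h1, h2, h3⟩ := lineCurrent_eq (tKir z)
  intro i hi
  rw [crossed_ph, Finset.mem_insert, Finset.mem_singleton] at hi
  have e5 : tKir z (0, 3) = ((z 0 + z 1 + z 2) * (z 5 + (z 1 + z 2 + z 3)) - (z 1 + z 2) * (z 1 + z 2 + z 3)) / D z := by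
    simp [tKir]
  have e6 : tKir z (1, 4) = ((z 1 + z 2 + z 3) * (z 4 + (z 0 + z 1 + z 2)) - (z 1 + z 2) * (z 0 + z 1 + z 2)) / D z := by
    simp [tKir]
  rcases hi with rfl | rfl
  · change zγ z (0, 3) * tKir z (0, 3) = ∑ k ∈ Finset.Ico 0 3, zl z k * crossed.lineCurrent (tKir z) k
    rw [sum_Ico_03, h0, h1, h2, e5, e6]
    simp only [zl, zγ, if_true, if_false, one_ne_zero, show (2:ℕ) ≠ 0 from by decide, show (2:ℕ) ≠ 1 from by decide]
    field_simp
    rw [D_eq_det]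
    ring
  · change zγ z (1, 4) * tKir z (1, 4) = ∑ k ∈ Finset.Ico 1 4, zl z k * crossed.lineCurrent (tKir z) k
    rw [sum_Ico_14, h1, h2, h3, e5, e6]
    simp only [zl, zγ, if_true, if_false, one_ne_zero, show (2:ℕ) ≠ 0 from by decide, show (2:ℕ) ≠ 1 from by decide,
      show (3:ℕ) ≠ 0 from by decide, show (3:ℕ) ≠ 1 from by decide, show (3:ℕ) ≠ 2 from by decide,
      show ((1:ℕ), (4:ℕ)) ≠ ((0:ℕ), (3:ℕ)) from by decide]
    field_simp
    rw [D_eq_det]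
    ring

/-- Z₀ = z₁ + z₂ + z₃ + z₄ on `crossed`. [cite: Volkov2020, eq. (2.4) «Z₀(z) = Σ_{l∈Lept(E(G))} z_l» (journal p.10)] -/
theorem Z0_eq : crossed.Z0 (zl z) = z 0 + z 1 + z 2 + z 3 := by
  unfold PathSkeleton.Z0
  change ∑ k ∈ Finset.range 4, zl z k = _
  rw [sum_range_4]
  simp [zl]

/-- **Z = Z₀ − N/D on `crossed`** (Thomson: Z is the voltage drop of the Kirchhoff distribution `tKir`).
[cite: Volkov2020, eq. (2.4) «Z(z) is the resistance between the vertexes that are incident to the external lepton lines» (journal p.10)] -/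
theorem effRes_eq (hz : ∀ i, 0 < z i) : crossed.effRes (zl z) (zγ z) = (z 0 + z 1 + z 2 + z 3) - wNum z / D z := by
  have hD : D z ≠ 0 := (D_pos hz).ne'
  rw [PathSkeleton.effRes_eq_voltage_of_KVL (zl_pos hz) (zγ_pos hz) (kvl hz)]
  change ∑ k ∈ Finset.range 4, zl z k * crossed.lineCurrent (tKir z) k = _
  obtain ⟨h0, h1, h2, h3⟩ := lineCurrent_eq (tKir z)
  rw [sum_range_4, h0, h1, h2, h3]
  simp only [zl, tKir, wNum, if_true, if_false, one_ne_zero, show (2:ℕ) ≠ 0 from by decide, show (2:ℕ) ≠ 1 from by decide,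
    show (3:ℕ) ≠ 0 from by decide, show (3:ℕ) ≠ 1 from by decide, show (3:ℕ) ≠ 2 from by decide,
    show ((1:ℕ), (4:ℕ)) ≠ ((0:ℕ), (3:ℕ)) from by decide]
  field_simp
  rw [D_eq_det]
  ring

/-- **W(z) = m²(Z − Z₀) = −m²·N(z)/D(z) on Fig. 2's graph**, eq. (2.4) in closed form. [cite: Volkov2020, eq. (2.4) (journal p.10); Appendix «W ∼ …» (p.19)] -/
theorem W_eq (hz : ∀ i, 0 < z i) (m : ℝ) : crossed.W m (zl z) (zγ z) = -(m ^ 2 * (wNum z / D z)) := by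
  unfold PathSkeleton.W
  rw [effRes_eq hz, Z0_eq]
  ring

/-! ## §4 The printed ray and the printed asymptotic statements -/

/-- **The Appendix ray**: z₁ = Λδ, z₂ = z₃ = z₄ = δ², z₅ = 1 − Λδ − 3δ² − Λδ² (∼ 1; on the simplex Σz = 1), z₆ = Λδ².
[cite: Volkov2020, Appendix (journal p.19; tex l.632–635)] -/
def ray (Λ δ : ℝ) : Fin 6 → ℝ := ![Λ * δ, δ ^ 2, δ ^ 2, δ ^ 2, 1 - Λ * δ - 3 * δ ^ 2 - Λ * δ ^ 2, Λ * δ ^ 2]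

/-- «f(δ) ∼ g(δ), if lim_{δ→0} f(δ)/g(δ) = 1» (δ → 0 through positive values, the parameters being positive). [cite: Volkov2020, Appendix (journal p.19; tex l.635)] -/
def Sim (f g : ℝ → ℝ) : Prop := Tendsto (fun δ => f δ / g δ) (𝓝[>] 0) (𝓝 1)

/-- «f(δ) ≍ g(δ), if 0 < C₁ ≤ |f(δ)/g(δ)| < C₂ for all 0 < δ < δ₀, where δ₀ > 0». [cite: Volkov2020, Appendix (journal p.19; tex l.635–636)] -/
def Comp (f g : ℝ → ℝ) : Prop :=
  ∃ C₁ C₂ δ₀ : ℝ, 0 < C₁ ∧ 0 < δ₀ ∧ ∀ δ, 0 < δ → δ < δ₀ → C₁ ≤ |f δ / g δ| ∧ |f δ / g δ| < C₂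

section Ray

variable (Λ δ : ℝ)

/-- z₁ = Λδ. [cite: Volkov2020, Appendix (journal p.19; tex l.632–634)] -/
@[simp] theorem ray_0 : ray Λ δ 0 = Λ * δ := rfl
/-- z₂ = δ². [cite: Volkov2020, Appendix (journal p.19; tex l.632–634)] -/
@[simp] theorem ray_1 : ray Λ δ 1 = δ ^ 2 := rfl
/-- z₃ = δ². [cite: Volkov2020, Appendix (journal p.19; tex l.632–634)] -/
@[simp] theorem ray_2 : ray Λ δ 2 = δ ^ 2 := rfl
/-- z₄ = δ². [cite: Volkov2020, Appendix (journal p.19; tex l.632–634)] -/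
@[simp] theorem ray_3 : ray Λ δ 3 = δ ^ 2 := rfl
/-- z₅ = 1 − Λδ − 3δ² − Λδ² (∼ 1; the simplex value). [cite: Volkov2020, Appendix «z₅ ∼ 1» (journal p.19; tex l.632–634)] -/
@[simp] theorem ray_4 : ray Λ δ 4 = 1 - Λ * δ - 3 * δ ^ 2 - Λ * δ ^ 2 := rfl
/-- z₆ = Λδ². [cite: Volkov2020, Appendix (journal p.19; tex l.632–634)] -/
@[simp] theorem ray_5 : ray Λ δ 5 = Λ * δ ^ 2 := rfl

/-- The ray lies on the simplex δ(z₁ + … + z₆ − 1) of (1.7). [cite: Volkov2020, eq. (1.7) (journal p.4); Appendix (p.19)] -/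
theorem ray_sum : ∑ i, ray Λ δ i = 1 := by
  simp only [Fin.sum_univ_six, ray_0, ray_1, ray_2, ray_3, ray_4, ray_5]
  ring

variable {Λ δ}

/-- For 0 < δ < 1/(2Λ+5) (Λ > 0) the fifth parameter z₅ = 1 − Λδ − 3δ² − Λδ² exceeds δ² (in particular it is positive).
[cite: Volkov2020, Appendix «z₅ ∼ 1», «δ → 0» (journal p.19; tex l.633)] -/
theorem ray4_gt (hΛ : 0 < Λ) (hδ : 0 < δ) (hδ' : δ < 1 / (2 * Λ + 5)) : δ ^ 2 < ray Λ δ 4 := by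
  rw [ray_4]
  have h1 : δ < 1 := by
    have : 1 / (2 * Λ + 5) ≤ 1 := by rw [div_le_one (by positivity)]; linarith
    linarith
  have h2 : (2 * Λ + 5) * δ < 1 := by rwa [lt_div_iff₀ (by positivity), mul_comm] at hδ'
  have h3 : δ ^ 2 ≤ δ := by nlinarith
  nlinarith

/-- Positivity of all six parameters on the ray for 0 < δ < 1/(2Λ+5). [cite: Volkov2020, Appendix (journal p.19)] -/
theorem ray_pos (hΛ : 0 < Λ) (hδ : 0 < δ) (hδ' : δ < 1 / (2 * Λ + 5)) : ∀ i, 0 < ray Λ δ i := by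
  have h4 := ray4_gt hΛ hδ hδ'
  intro i
  fin_cases i
  · exact mul_pos hΛ hδ
  · exact pow_pos hδ 2
  · exact pow_pos hδ 2
  · exact pow_pos hδ 2
  · exact lt_trans (pow_pos hδ 2) h4
  · exact mul_pos hΛ (pow_pos hδ 2)

variable (Λ δ)

/-- **D on the ray, exactly**: D = (Λ+3)δ² − (Λ²+4Λ+7)δ⁴ (the δ³ terms cancel). [cite: Volkov2020, Appendix «D ∼ (Λ+3)δ²» (journal p.19; tex l.638)] -/
theorem D_ray : D (ray Λ δ) = (Λ + 3) * δ ^ 2 - (Λ ^ 2 + 4 * Λ + 7) * δ ^ 4 := by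
  rw [D_eq]; simp only [ray_0, ray_1, ray_2, ray_3, ray_4, ray_5]; ring

/-- **N on the ray, exactly**: N = (Λ³+3Λ²+9)δ⁴ + 4Λ²δ⁵ − (5Λ+21)δ⁶. [cite: Volkov2020, Appendix «W ∼ −m²(9/(Λ+3)+Λ²)δ²» (journal p.19; tex l.638)] -/
theorem wNum_ray : wNum (ray Λ δ) = (Λ ^ 3 + 3 * Λ ^ 2 + 9) * δ ^ 4 + 4 * Λ ^ 2 * δ ^ 5 - (5 * Λ + 21) * δ ^ 6 := by
  unfold wNum; simp only [ray_0, ray_1, ray_2, ray_3, ray_4, ray_5]; ring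

/-- **B₁₂ = (Λ+1)δ²** on the ray (an identity). [cite: Volkov2020, Appendix (journal p.19; tex l.640)] -/
theorem B12_ray : B 0 1 (ray Λ δ) = (Λ + 1) * δ ^ 2 := by rw [B12_eq, ray_3, ray_5]; ring
/-- **B₁₃ = (Λ+1)δ²**. [cite: Volkov2020, Appendix (journal p.19; tex l.640)] -/
theorem B13_ray : B 0 2 (ray Λ δ) = (Λ + 1) * δ ^ 2 := by rw [B13_eq, ray_3, ray_5]; ring
/-- **B₁₄ = −2δ²**. [cite: Volkov2020, Appendix (journal p.19; tex l.640)] -/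
theorem B14_ray : B 0 3 (ray Λ δ) = -(2 * δ ^ 2) := by rw [B14_eq, ray_1, ray_2]; ring
/-- B₂₃ = 1 − 2δ² on the ray, exactly. [cite: Volkov2020, Appendix «B₂₃ … ∼ 1» (journal p.19; tex l.640)] -/
theorem B23_ray : B 1 2 (ray Λ δ) = 1 - 2 * δ ^ 2 := by rw [B23_eq, ray_0, ray_3, ray_4, ray_5]; ring
/-- B₂₄ = B₃₄ = 1 − (Λ+3)δ² exactly. [cite: Volkov2020, Appendix «B₂₄ = B₃₄ ∼ 1» (journal p.19; tex l.640)] -/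
theorem B24_ray : B 1 3 (ray Λ δ) = 1 - (Λ + 3) * δ ^ 2 := by rw [B24_eq, ray_0, ray_4]; ring
/-- B₃₄ = 1 − (Λ+3)δ². [cite: Volkov2020, Appendix (journal p.19; tex l.640)] -/
theorem B34_ray : B 2 3 (ray Λ δ) = 1 - (Λ + 3) * δ ^ 2 := by rw [B34_eq, ray_0, ray_4]; ring

/-- **z₁⋯z₆ on the ray, exactly**: Λ²δ⁹·z₅. [cite: Volkov2020, Appendix «z₁…z₆ ≍ δ⁹» (journal p.19; tex l.642)] -/
theorem prod_ray : ∏ i, ray Λ δ i = Λ ^ 2 * δ ^ 9 * (1 - Λ * δ - 3 * δ ^ 2 - Λ * δ ^ 2) := by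
  simp only [Fin.prod_univ_six, ray_0, ray_1, ray_2, ray_3, ray_4, ray_5]; ring

/-- D/δ² on the ray as a polynomial: pD = (Λ+3) − (Λ²+4Λ+7)δ². [cite: Volkov2020, Appendix «D ∼ (Λ+3)δ²» (journal p.19)] -/
def pD : ℝ := (Λ + 3) - (Λ ^ 2 + 4 * Λ + 7) * δ ^ 2

/-- N/δ⁴ on the ray as a polynomial: pN = (Λ³+3Λ²+9) + 4Λ²δ − (5Λ+21)δ². [cite: Volkov2020, Appendix «W ∼ …» (journal p.19)] -/
def pN : ℝ := (Λ ^ 3 + 3 * Λ ^ 2 + 9) + 4 * Λ ^ 2 * δ - (5 * Λ + 21) * δ ^ 2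

/-- D = δ²·pD on the ray. [cite: Volkov2020, Appendix (journal p.19)] -/
theorem D_ray_pD : D (ray Λ δ) = δ ^ 2 * pD Λ δ := by rw [D_ray, pD]; ring

/-- N = δ⁴·pN on the ray. [cite: Volkov2020, Appendix (journal p.19)] -/
theorem wNum_ray_pN : wNum (ray Λ δ) = δ ^ 4 * pN Λ δ := by rw [wNum_ray, pN]; ring

/-- pD → Λ + 3 as δ → 0⁺. [cite: Volkov2020, Appendix «D ∼ (Λ+3)δ²» (journal p.19)] -/
theorem tendsto_pD : Tendsto (pD Λ) (𝓝[>] 0) (𝓝 (Λ + 3)) := by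
  have hc : Continuous (pD Λ) := by unfold pD; fun_prop
  exact (hc.tendsto' 0 _ (by simp [pD])).mono_left nhdsWithin_le_nhds

/-- pN → Λ³ + 3Λ² + 9 as δ → 0⁺. [cite: Volkov2020, Appendix «W ∼ …» (journal p.19)] -/
theorem tendsto_pN : Tendsto (pN Λ) (𝓝[>] 0) (𝓝 (Λ ^ 3 + 3 * Λ ^ 2 + 9)) := by
  have hc : Continuous (pN Λ) := by unfold pN; fun_prop
  exact (hc.tendsto' 0 _ (by simp [pN])).mono_left nhdsWithin_le_nhds

/-- z₅ = 1 − Λδ − 3δ² − Λδ² → 1 as δ → 0⁺ («z₅ ∼ 1»). [cite: Volkov2020, Appendix «z₅ ∼ 1» (journal p.19; tex l.633)] -/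
theorem tendsto_ray4 : Tendsto (fun δ => ray Λ δ 4) (𝓝[>] 0) (𝓝 1) := by
  have hc : Continuous (fun δ => ray Λ δ 4) := by simp only [ray_4]; fun_prop
  exact (hc.tendsto' 0 _ (by simp)).mono_left nhdsWithin_le_nhds

variable {Λ δ}

/-- Two functions agreeing on some (0, δ₀) have the same limit as δ → 0⁺. [folklore] -/
private theorem tendsto_of_eqOn {f g : ℝ → ℝ} {c δ₀ : ℝ} (h0 : 0 < δ₀) (hfg : ∀ δ, 0 < δ → δ < δ₀ → f δ = g δ)
    (hg : Tendsto g (𝓝[>] 0) (𝓝 c)) : Tendsto f (𝓝[>] 0) (𝓝 c) := by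
  refine hg.congr' ?_
  filter_upwards [Ioo_mem_nhdsGT h0] with δ hδ
  exact (hfg δ hδ.1 hδ.2).symm

/-- 1/(2Λ+5) > 0. [folklore] -/
private theorem delta0_pos (hΛ : 0 < Λ) : 0 < 1 / (2 * Λ + 5) := by positivity

/-- **«D ∼ (Λ+3)δ²»**. [cite: Volkov2020, Appendix (journal p.19; tex l.638)] -/
theorem D_sim (hΛ : 0 < Λ) : Sim (fun δ => D (ray Λ δ)) (fun δ => (Λ + 3) * δ ^ 2) := by
  unfold Sim
  have hne : (Λ + 3 : ℝ) ≠ 0 := by positivity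
  have h := (tendsto_pD Λ).div_const (Λ + 3)
  rw [div_self hne] at h
  refine tendsto_of_eqOn zero_lt_one (fun δ hδ _ => ?_) h
  show D (ray Λ δ) / ((Λ + 3) * δ ^ 2) = pD Λ δ / (Λ + 3)
  have hδ0 : δ ≠ 0 := hδ.ne'
  rw [D_ray_pD, div_eq_div_iff (by positivity) hne]
  ring

/-- **«W ∼ −m²(9/(Λ+3) + Λ²)δ²»** for the tree's W = m²(Z − Z₀) of eq. (2.4) on Fig. 2's graph (m ≠ 0, Λ > 0).
[cite: Volkov2020, Appendix (journal p.19; tex l.638); eq. (2.4) (p.10)] -/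
theorem W_sim (hΛ : 0 < Λ) {m : ℝ} (hm : m ≠ 0) :
    Sim (fun δ => crossed.W m (zl (ray Λ δ)) (zγ (ray Λ δ))) (fun δ => -(m ^ 2 * (9 / (Λ + 3) + Λ ^ 2) * δ ^ 2)) := by
  unfold Sim
  have hκ : (0 : ℝ) < 9 / (Λ + 3) + Λ ^ 2 := by positivity
  have h : Tendsto (fun δ => pN Λ δ / (pD Λ δ * (9 / (Λ + 3) + Λ ^ 2))) (𝓝[>] 0)
      (𝓝 ((Λ ^ 3 + 3 * Λ ^ 2 + 9) / ((Λ + 3) * (9 / (Λ + 3) + Λ ^ 2)))) :=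
    (tendsto_pN Λ).div ((tendsto_pD Λ).mul_const (9 / (Λ + 3) + Λ ^ 2)) (by positivity)
  have e : (Λ ^ 3 + 3 * Λ ^ 2 + 9) / ((Λ + 3) * (9 / (Λ + 3) + Λ ^ 2)) = 1 := by
    rw [div_eq_one_iff_eq (by positivity)]
    field_simp
    ring
  rw [e] at h
  refine tendsto_of_eqOn (delta0_pos hΛ) (fun δ hδ hδ' => ?_) h
  have hz := ray_pos hΛ hδ hδ'
  have hD : D (ray Λ δ) ≠ 0 := (D_pos hz).ne'
  rw [D_ray_pD] at hD
  have hpD : pD Λ δ ≠ 0 := fun h0 => hD (by rw [h0, mul_zero])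
  have hδ0 : δ ≠ 0 := hδ.ne'
  have hm2 : m ^ 2 ≠ 0 := by positivity
  have hκne : (9 / (Λ + 3) + Λ ^ 2 : ℝ) ≠ 0 := hκ.ne'
  show crossed.W m (zl (ray Λ δ)) (zγ (ray Λ δ)) / (-(m ^ 2 * (9 / (Λ + 3) + Λ ^ 2) * δ ^ 2)) =
    pN Λ δ / (pD Λ δ * (9 / (Λ + 3) + Λ ^ 2))
  rw [W_eq hz, D_ray_pD, wNum_ray_pN]
  have e1 : -(m ^ 2 * (δ ^ 4 * pN Λ δ / (δ ^ 2 * pD Λ δ))) = -(m ^ 2 * δ ^ 2 * pN Λ δ) / pD Λ δ := by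
    rw [neg_div, neg_inj, eq_div_iff hpD, mul_assoc (m ^ 2), div_mul_eq_mul_div, ← mul_div_assoc (m ^ 2),
      div_eq_iff hD]
    ring
  rw [e1, div_div, div_eq_div_iff (mul_ne_zero hpD (neg_ne_zero.2 (mul_ne_zero (mul_ne_zero hm2 hκne) (pow_ne_zero 2 hδ0))))
    (mul_ne_zero hpD hκne)]
  ring

/-- **«B₂₃ ∼ 1»**. [cite: Volkov2020, Appendix (journal p.19; tex l.640)] -/
theorem B23_sim : Sim (fun δ => B 1 2 (ray Λ δ)) (fun _ => 1) := by
  unfold Sim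
  have hc : Continuous fun δ : ℝ => 1 - 2 * δ ^ 2 := by fun_prop
  have h := (hc.tendsto' 0 1 (by norm_num)).mono_left (nhdsWithin_le_nhds (s := Set.Ioi (0:ℝ)))
  refine h.congr' (Eventually.of_forall fun δ => ?_)
  simp only [B23_ray, div_one]

/-- **«B₂₄ ∼ 1»**. [cite: Volkov2020, Appendix (journal p.19; tex l.640)] -/
theorem B24_sim : Sim (fun δ => B 1 3 (ray Λ δ)) (fun _ => 1) := by
  unfold Sim
  have hc : Continuous fun δ : ℝ => 1 - (Λ + 3) * δ ^ 2 := by fun_prop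
  have h := (hc.tendsto' 0 1 (by norm_num)).mono_left (nhdsWithin_le_nhds (s := Set.Ioi (0:ℝ)))
  refine h.congr' (Eventually.of_forall fun δ => ?_)
  simp only [B24_ray, div_one]

/-- **«B₃₄ ∼ 1»**. [cite: Volkov2020, Appendix (journal p.19; tex l.640)] -/
theorem B34_sim : Sim (fun δ => B 2 3 (ray Λ δ)) (fun _ => 1) := by
  have h := B24_sim (Λ := Λ)
  unfold Sim at h ⊢
  refine h.congr' (Eventually.of_forall fun δ => ?_)
  simp only [B24_eq_B34]

/-- **min(z₁,…,z₆) = δ² (= z₂) on the ray** for Λ ≥ 1 and 0 < δ < 1/(2Λ+5). [cite: Volkov2020, Appendix «min(z₁,…,z₆) ≍ δ²» (journal p.19; tex l.642)] -/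
theorem min_ray (hΛ : 1 ≤ Λ) (hδ : 0 < δ) (hδ' : δ < 1 / (2 * Λ + 5)) :
    Finset.univ.inf' ⟨0, Finset.mem_univ _⟩ (ray Λ δ) = δ ^ 2 := by
  have hΛ0 : 0 < Λ := by linarith
  have h4 := ray4_gt hΛ0 hδ hδ'
  have h1 : δ < 1 := by
    have : 1 / (2 * Λ + 5) ≤ 1 := by rw [div_le_one (by positivity)]; linarith
    linarith
  refine le_antisymm (Finset.inf'_le _ (Finset.mem_univ 1)) (Finset.le_inf' _ _ fun i _ => ?_)
  fin_cases i
  · change δ ^ 2 ≤ Λ * δ; nlinarith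
  · exact le_rfl
  · exact le_rfl
  · exact le_rfl
  · exact h4.le
  · change δ ^ 2 ≤ Λ * δ ^ 2; nlinarith [pow_pos hδ 2]

/-- **«min(z₁,…,z₆) ≍ δ²»** (Λ ≥ 1; C₁ = 1, C₂ = 2, δ₀ = 1/(2Λ+5) — the ratio is identically 1 there). [cite: Volkov2020, Appendix (journal p.19; tex l.642)] -/
theorem min_comp (hΛ : 1 ≤ Λ) : Comp (fun δ => Finset.univ.inf' ⟨0, Finset.mem_univ _⟩ (ray Λ δ)) (fun δ => δ ^ 2) := by
  refine ⟨1, 2, 1 / (2 * Λ + 5), one_pos, delta0_pos (by linarith), fun δ hδ hδ' => ?_⟩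
  dsimp only
  rw [min_ray hΛ hδ hδ', div_self (pow_pos hδ 2).ne', abs_one]
  norm_num

/-- **«z₁…z₆ ≍ δ⁹»** (Λ > 0; C₁ = Λ²/(2Λ+5), C₂ = Λ², δ₀ = 1/(2Λ+5): the ratio is Λ²z₅ with 1/(2Λ+5) < z₅ < 1). [cite: Volkov2020, Appendix (journal p.19; tex l.642)] -/
theorem prod_comp (hΛ : 0 < Λ) : Comp (fun δ => ∏ i, ray Λ δ i) (fun δ => δ ^ 9) := by
  refine ⟨Λ ^ 2 / (2 * Λ + 5), Λ ^ 2, 1 / (2 * Λ + 5), by positivity, delta0_pos hΛ, fun δ hδ hδ' => ?_⟩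
  have hδ9 : δ ^ 9 ≠ 0 := (pow_pos hδ 9).ne'
  have e : (∏ i, ray Λ δ i) / δ ^ 9 = Λ ^ 2 * (1 - Λ * δ - 3 * δ ^ 2 - Λ * δ ^ 2) := by
    rw [prod_ray]; field_simp
  have h1 : δ < 1 := by
    have : 1 / (2 * Λ + 5) ≤ 1 := by rw [div_le_one (by positivity)]; linarith
    linarith
  have h2 : (2 * Λ + 5) * δ < 1 := by rwa [lt_div_iff₀ (by positivity), mul_comm] at hδ'
  have hs_lt : 1 - Λ * δ - 3 * δ ^ 2 - Λ * δ ^ 2 < 1 := by nlinarith [mul_pos hΛ hδ]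
  have hs_gt : 1 / (2 * Λ + 5) < 1 - Λ * δ - 3 * δ ^ 2 - Λ * δ ^ 2 := by
    have h3 : δ ^ 2 ≤ δ := by nlinarith
    have h5 : 1 / (2 * Λ + 5) = 1 - (2 * Λ + 4) * (1 / (2 * Λ + 5)) := by field_simp; ring
    nlinarith
  have hs_pos : 0 < 1 - Λ * δ - 3 * δ ^ 2 - Λ * δ ^ 2 := lt_trans (delta0_pos hΛ) hs_gt
  dsimp only
  rw [e, abs_of_pos (by positivity)]
  constructor
  · rw [div_eq_mul_one_div]
    exact mul_le_mul_of_nonneg_left hs_gt.le (by positivity)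
  · calc Λ ^ 2 * (1 - Λ * δ - 3 * δ ^ 2 - Λ * δ ^ 2) < Λ ^ 2 * 1 := mul_lt_mul_of_pos_left hs_lt (by positivity)
      _ = Λ ^ 2 := mul_one _

/-- The (1.9) majorant on the ray: (min z)^{1/2}/(z₁⋯z₆) = 1/(Λ² z₅ δ⁸) for Λ ≥ 1, 0 < δ < 1/(2Λ+5).
[cite: Volkov2020, eq. (1.9) (journal p.5); Appendix «≍ 1/δ⁸» (p.19; tex l.644–646)] -/
theorem majorant_ray (hΛ : 1 ≤ Λ) (hδ : 0 < δ) (hδ' : δ < 1 / (2 * Λ + 5)) :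
    Real.sqrt (Finset.univ.inf' ⟨0, Finset.mem_univ _⟩ (ray Λ δ)) / ∏ i, ray Λ δ i =
      1 / (Λ ^ 2 * (1 - Λ * δ - 3 * δ ^ 2 - Λ * δ ^ 2) * δ ^ 8) := by
  have hΛ0 : 0 < Λ := by linarith
  have hs : 0 < 1 - Λ * δ - 3 * δ ^ 2 - Λ * δ ^ 2 := lt_trans (pow_pos hδ 2) (ray4_gt hΛ0 hδ hδ')
  rw [min_ray hΛ hδ hδ', prod_ray, Real.sqrt_sq hδ.le]
  have hδ0 : δ ≠ 0 := hδ.ne'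
  rw [div_eq_div_iff (by positivity) (by positivity)]
  ring

/-- **«(min(z₁,…,z₆))^{1/2}/(z₁…z₆) ≍ 1/δ⁸»** (Λ ≥ 1; C₁ = 1/Λ², C₂ = (2Λ+5)/Λ² + 1, δ₀ = 1/(2Λ+5)).
[cite: Volkov2020, Appendix (journal p.19; tex l.643–646)] -/
theorem majorant_comp (hΛ : 1 ≤ Λ) :
    Comp (fun δ => Real.sqrt (Finset.univ.inf' ⟨0, Finset.mem_univ _⟩ (ray Λ δ)) / ∏ i, ray Λ δ i) (fun δ => 1 / δ ^ 8) := by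
  have hΛ0 : 0 < Λ := by linarith
  refine ⟨1 / Λ ^ 2, (2 * Λ + 5) / Λ ^ 2 + 1, 1 / (2 * Λ + 5), by positivity, delta0_pos hΛ0, fun δ hδ hδ' => ?_⟩
  have h4 := ray4_gt hΛ0 hδ hδ'
  rw [ray_4] at h4
  have hs : 0 < 1 - Λ * δ - 3 * δ ^ 2 - Λ * δ ^ 2 := lt_trans (pow_pos hδ 2) h4
  have h1 : δ < 1 := by
    have : 1 / (2 * Λ + 5) ≤ 1 := by rw [div_le_one (by positivity)]; linarith
    linarith
  have h2 : (2 * Λ + 5) * δ < 1 := by rwa [lt_div_iff₀ (by positivity), mul_comm] at hδ'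
  have hs_lt : 1 - Λ * δ - 3 * δ ^ 2 - Λ * δ ^ 2 < 1 := by nlinarith [mul_pos hΛ0 hδ]
  have hs_gt : 1 / (2 * Λ + 5) < 1 - Λ * δ - 3 * δ ^ 2 - Λ * δ ^ 2 := by
    have h3 : δ ^ 2 ≤ δ := by nlinarith
    have h5 : 1 / (2 * Λ + 5) = 1 - (2 * Λ + 4) * (1 / (2 * Λ + 5)) := by field_simp; ring
    nlinarith
  have e : Real.sqrt (Finset.univ.inf' ⟨0, Finset.mem_univ _⟩ (ray Λ δ)) / (∏ i, ray Λ δ i) / (1 / δ ^ 8) =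
      1 / (Λ ^ 2 * (1 - Λ * δ - 3 * δ ^ 2 - Λ * δ ^ 2)) := by
    rw [majorant_ray hΛ hδ hδ']
    have hδ0 : δ ≠ 0 := hδ.ne'
    rw [div_div_eq_mul_div, div_one, one_div_mul_eq_div, div_eq_div_iff (by positivity) (by positivity)]
    ring
  dsimp only
  rw [e, abs_of_pos (by positivity)]
  constructor
  · rw [one_div_le_one_div (by positivity) (by positivity)]
    calc Λ ^ 2 * (1 - Λ * δ - 3 * δ ^ 2 - Λ * δ ^ 2) ≤ Λ ^ 2 * 1 := mul_le_mul_of_nonneg_left hs_lt.le (by positivity)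
      _ = Λ ^ 2 := mul_one _
  · have h6 : 1 / (Λ ^ 2 * (1 - Λ * δ - 3 * δ ^ 2 - Λ * δ ^ 2)) < (2 * Λ + 5) / Λ ^ 2 := by
      rw [div_lt_div_iff₀ (by positivity) (by positivity)]
      have h7 : Λ ^ 2 * 1 < Λ ^ 2 * ((2 * Λ + 5) * (1 - Λ * δ - 3 * δ ^ 2 - Λ * δ ^ 2)) := by
        refine mul_lt_mul_of_pos_left ?_ (by positivity)
        have := (div_lt_iff₀' (by positivity : (0:ℝ) < 2 * Λ + 5)).1 hs_gt
        linarith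
      nlinarith
    linarith

/-! ## §5 The |P| = 1 factors B_{l₁l₂}/(D³W) are of the majorant's order δ⁻⁸; with projector values of non-zero sum the dominant terms are ≍ the majorant -/

/-- The common limit constant −1/(m²(Λ+3)²(Λ³+3Λ²+9)) of δ⁸·B/(D³W) (= −1/((Λ+3)³·m²(9/(Λ+3)+Λ²)) in the printed constants).
[cite: Volkov2020, Appendix «B₂₃/(D³W)» (journal p.19; tex l.650–652)] -/
noncomputable def pairLimit (Λ m : ℝ) : ℝ := -(1 / (m ^ 2 * (Λ + 3) ^ 2 * (Λ ^ 3 + 3 * Λ ^ 2 + 9)))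

/-- The limit constant is non-zero (Λ > 0, m ≠ 0). [cite: Volkov2020, Appendix (journal p.19)] -/
theorem pairLimit_ne_zero (hΛ : 0 < Λ) {m : ℝ} (hm : m ≠ 0) : pairLimit Λ m ≠ 0 := by
  unfold pairLimit
  have : 0 < m ^ 2 := by positivity
  exact neg_ne_zero.2 (one_div_ne_zero (by positivity))

/-- It equals the printed-constant form −1/((Λ+3)³·m²·(9/(Λ+3)+Λ²)). [cite: Volkov2020, Appendix «D ∼ (Λ+3)δ², W ∼ −m²(9/(Λ+3)+Λ²)δ²» (journal p.19)] -/
theorem pairLimit_eq (hΛ : 0 < Λ) {m : ℝ} (hm : m ≠ 0) :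
    pairLimit Λ m = -(1 / ((Λ + 3) ^ 3 * (m ^ 2 * (9 / (Λ + 3) + Λ ^ 2)))) := by
  unfold pairLimit
  have hm2 : 0 < m ^ 2 := by positivity
  congr 1
  rw [div_eq_div_iff (by positivity) (by positivity)]
  field_simp
  ring

/-- The generic limit behind §5: if b(δ) → 1 (a «∼ 1» factor) then δ⁸·b/(D³W) → `pairLimit` along the ray. [cite: Volkov2020, Appendix (journal p.19; tex l.650–652)] -/
theorem factor_tendsto (hΛ : 0 < Λ) {m : ℝ} (hm : m ≠ 0) {b : ℝ → ℝ} (hb : Tendsto b (𝓝[>] 0) (𝓝 1)) :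
    Tendsto (fun δ => δ ^ 8 * (b δ / (D (ray Λ δ) ^ 3 * crossed.W m (zl (ray Λ δ)) (zγ (ray Λ δ)))))
      (𝓝[>] 0) (𝓝 (pairLimit Λ m)) := by
  -- δ⁸·b/(D³W) = −b / (m²·pD²·pN) on (0, δ₀), and the right-hand side is a quotient of convergent factors
  have hm2 : 0 < m ^ 2 := by positivity
  have hden : Tendsto (fun δ => m ^ 2 * pD Λ δ ^ 2 * pN Λ δ) (𝓝[>] 0)
      (𝓝 (m ^ 2 * (Λ + 3) ^ 2 * (Λ ^ 3 + 3 * Λ ^ 2 + 9))) :=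
    (tendsto_const_nhds.mul ((tendsto_pD Λ).pow 2)).mul (tendsto_pN Λ)
  have hg : Tendsto (fun δ => -(b δ / (m ^ 2 * pD Λ δ ^ 2 * pN Λ δ))) (𝓝[>] 0) (𝓝 (pairLimit Λ m)) := by
    unfold pairLimit
    exact (hb.div hden (by positivity)).neg
  refine tendsto_of_eqOn (delta0_pos hΛ) (fun δ hδ hδ' => ?_) hg
  have hz := ray_pos hΛ hδ hδ'
  have hD : D (ray Λ δ) ≠ 0 := (D_pos hz).ne'
  rw [D_ray_pD] at hD
  have hpD : pD Λ δ ≠ 0 := fun h0 => hD (by rw [h0, mul_zero])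
  have hδ0 : δ ≠ 0 := hδ.ne'
  rw [W_eq hz, D_ray_pD, wNum_ray_pN]
  by_cases hN : pN Λ δ = 0
  · simp [hN]
  have key : (δ ^ 2 * pD Λ δ) ^ 3 * -(m ^ 2 * (δ ^ 4 * pN Λ δ / (δ ^ 2 * pD Λ δ))) =
      -(m ^ 2 * pD Λ δ ^ 2 * pN Λ δ) * δ ^ 8 := by
    have e2 : δ ^ 4 * pN Λ δ / (δ ^ 2 * pD Λ δ) = δ ^ 2 * pN Λ δ / pD Λ δ := by
      rw [div_eq_div_iff hD hpD]
      ring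
    rw [e2, mul_neg, neg_mul, neg_inj, ← mul_div_assoc (m ^ 2), mul_div_assoc', div_eq_iff hpD]
    ring
  have hQ : m ^ 2 * pD Λ δ ^ 2 * pN Λ δ ≠ 0 := mul_ne_zero (mul_ne_zero hm2.ne' (pow_ne_zero 2 hpD)) hN
  have hY : (δ ^ 2 * pD Λ δ) ^ 3 * -(m ^ 2 * (δ ^ 4 * pN Λ δ / (δ ^ 2 * pD Λ δ))) ≠ 0 := by
    rw [key]; exact mul_ne_zero (neg_ne_zero.2 hQ) (pow_ne_zero 8 hδ0)
  rw [mul_div_assoc', ← neg_div, div_eq_div_iff hY hQ, key]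
  ring

/-- **δ⁸·B₂₃/(D³W) → −1/(m²(Λ+3)²(Λ³+3Λ²+9)) ≠ 0, and likewise for B₂₄, B₃₄**: each printed |P| = 1 factor is of the exact order δ⁻⁸ of the (1.9)
majorant along the ray. [cite: Volkov2020, Appendix «The contributions of these dominated terms are B₂₃/(D³W)𝒫[F₂₃], …» (journal p.19; tex l.648–652)] -/
theorem pairFactor_tendsto (hΛ : 0 < Λ) {m : ℝ} (hm : m ≠ 0) :
    Tendsto (fun δ => δ ^ 8 * (B 1 2 (ray Λ δ) / (D (ray Λ δ) ^ 3 * crossed.W m (zl (ray Λ δ)) (zγ (ray Λ δ)))))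
        (𝓝[>] 0) (𝓝 (pairLimit Λ m)) ∧
      Tendsto (fun δ => δ ^ 8 * (B 1 3 (ray Λ δ) / (D (ray Λ δ) ^ 3 * crossed.W m (zl (ray Λ δ)) (zγ (ray Λ δ)))))
        (𝓝[>] 0) (𝓝 (pairLimit Λ m)) ∧
      Tendsto (fun δ => δ ^ 8 * (B 2 3 (ray Λ δ) / (D (ray Λ δ) ^ 3 * crossed.W m (zl (ray Λ δ)) (zγ (ray Λ δ)))))
        (𝓝[>] 0) (𝓝 (pairLimit Λ m)) := by
  have s23 := B23_sim (Λ := Λ); have s24 := B24_sim (Λ := Λ); have s34 := B34_sim (Λ := Λ)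
  unfold Sim at s23 s24 s34
  simp only [div_one] at s23 s24 s34
  exact ⟨factor_tendsto hΛ hm s23, factor_tendsto hΛ hm s24, factor_tendsto hΛ hm s34⟩

/-- The sum of the three dominant |P| = 1 terms with projector values π₂₃, π₂₄, π₃₄ (abstract reals standing for 𝒫[F₂₃], 𝒫[F₂₄], 𝒫[F₃₄]).
[cite: Volkov2020, Appendix (journal p.19; tex l.648–652)] -/
noncomputable def dominantSum (Λ m π₂₃ π₂₄ π₃₄ δ : ℝ) : ℝ :=
  B 1 2 (ray Λ δ) / (D (ray Λ δ) ^ 3 * crossed.W m (zl (ray Λ δ)) (zγ (ray Λ δ))) * π₂₃ +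
    B 1 3 (ray Λ δ) / (D (ray Λ δ) ^ 3 * crossed.W m (zl (ray Λ δ)) (zγ (ray Λ δ))) * π₂₄ +
      B 2 3 (ray Λ δ) / (D (ray Λ δ) ^ 3 * crossed.W m (zl (ray Λ δ)) (zγ (ray Λ δ))) * π₃₄

/-- **δ⁸ · (Σ_P B_P/(D³W)·π_P) → (π₂₃ + π₂₄ + π₃₄)·pairLimit**. [cite: Volkov2020, Appendix «Since 𝒫[F₂₃+F₂₄+F₃₄] … ≠ 0, B₂₃ = B₂₄ = B₃₄, these
asymptotically dominated terms are not cancelled» (journal p.19; tex l.678)] -/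
theorem dominantSum_tendsto (hΛ : 0 < Λ) {m : ℝ} (hm : m ≠ 0) (π₂₃ π₂₄ π₃₄ : ℝ) :
    Tendsto (fun δ => δ ^ 8 * dominantSum Λ m π₂₃ π₂₄ π₃₄ δ) (𝓝[>] 0) (𝓝 ((π₂₃ + π₂₄ + π₃₄) * pairLimit Λ m)) := by
  obtain ⟨h23, h24, h34⟩ := pairFactor_tendsto hΛ hm
  have h := ((h23.mul_const π₂₃).add (h24.mul_const π₂₄)).add (h34.mul_const π₃₄)
  have e : pairLimit Λ m * π₂₃ + pairLimit Λ m * π₂₄ + pairLimit Λ m * π₃₄ = (π₂₃ + π₂₄ + π₃₄) * pairLimit Λ m := by ring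
  rw [e] at h
  refine h.congr' (Eventually.of_forall fun δ => ?_)
  simp only [dominantSum]
  ring

/-- **The dominant terms against the (1.9) majorant**: (Σ_P B_P/(D³W)·π_P) / ((min z)^{1/2}/(z₁⋯z₆)) → (π₂₃+π₂₄+π₃₄)·Λ²·pairLimit (Λ ≥ 1, m ≠ 0).
[cite: Volkov2020, Appendix (journal p.19; tex l.643–652, l.678); eq. (1.9) (p.5)] -/
theorem dominant_over_majorant_tendsto (hΛ : 1 ≤ Λ) {m : ℝ} (hm : m ≠ 0) (π₂₃ π₂₄ π₃₄ : ℝ) :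
    Tendsto (fun δ => dominantSum Λ m π₂₃ π₂₄ π₃₄ δ /
        (Real.sqrt (Finset.univ.inf' ⟨0, Finset.mem_univ _⟩ (ray Λ δ)) / ∏ i, ray Λ δ i))
      (𝓝[>] 0) (𝓝 ((π₂₃ + π₂₄ + π₃₄) * Λ ^ 2 * pairLimit Λ m)) := by
  have hΛ0 : 0 < Λ := by linarith
  -- quotient = (δ⁸·Σ) · Λ² · z₅(δ), and z₅ → 1
  have hs : Tendsto (fun δ : ℝ => Λ ^ 2 * (1 - Λ * δ - 3 * δ ^ 2 - Λ * δ ^ 2)) (𝓝[>] 0) (𝓝 (Λ ^ 2)) := by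
    have hc : Continuous fun δ : ℝ => Λ ^ 2 * (1 - Λ * δ - 3 * δ ^ 2 - Λ * δ ^ 2) := by continuity
    have h := hc.tendsto 0
    simp only [mul_zero, sub_zero, ne_eq, OfNat.ofNat_ne_zero, not_false_eq_true, zero_pow, mul_one] at h
    exact h.mono_left nhdsWithin_le_nhds
  have h := (dominantSum_tendsto hΛ0 hm π₂₃ π₂₄ π₃₄).mul hs
  have e : (π₂₃ + π₂₄ + π₃₄) * pairLimit Λ m * Λ ^ 2 = (π₂₃ + π₂₄ + π₃₄) * Λ ^ 2 * pairLimit Λ m := by ring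
  rw [e] at h
  refine h.congr' ?_
  filter_upwards [Ioo_mem_nhdsGT (delta0_pos hΛ0)] with δ hδ
  rw [majorant_ray hΛ hδ.1 hδ.2]
  have hδ0 : (δ : ℝ) ≠ 0 := hδ.1.ne'
  have hs0 : 1 - Λ * δ - 3 * δ ^ 2 - Λ * δ ^ 2 ≠ 0 := by
    have h4 := ray4_gt hΛ0 hδ.1 hδ.2
    rw [ray_4] at h4
    exact (lt_trans (pow_pos hδ.1 2) h4).ne'
  field_simp

/-- **Non-cancellation criterion**: the limit of (dominant terms)/(majorant) is non-zero iff π₂₃ + π₂₄ + π₃₄ ≠ 0 (Λ ≥ 1, m ≠ 0) — so for projector values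
of non-zero sum the three printed terms together are ≍ (min z)^{1/2}/(z₁⋯z₆): the power ½ of (1.9) is attained along this ray.
[cite: Volkov2020, Appendix last sentence (journal p.19; tex l.678); §1 «The power 1/2 in (1.9) is unimprovable» (p.5)] -/
theorem dominant_limit_ne_zero_iff (hΛ : 1 ≤ Λ) {m : ℝ} (hm : m ≠ 0) (π₂₃ π₂₄ π₃₄ : ℝ) :
    (π₂₃ + π₂₄ + π₃₄) * Λ ^ 2 * pairLimit Λ m ≠ 0 ↔ π₂₃ + π₂₄ + π₃₄ ≠ 0 := by
  have hΛ0 : 0 < Λ := by linarith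
  have hp := pairLimit_ne_zero hΛ0 hm
  have hΛ2 : Λ ^ 2 ≠ 0 := by positivity
  constructor
  · intro h h0; exact h (by rw [h0]; ring)
  · intro h; exact mul_ne_zero (mul_ne_zero h hΛ2) hp

/-- **With the printed projector values** 𝒫[F₂₃] = 16m², 𝒫[F₂₄] = −8m², 𝒫[F₃₄] = 0 (sum 8m² ≠ 0): (dominant terms)/(majorant) → −8Λ²/((Λ+3)²(Λ³+3Λ²+9)) ≠ 0.
[cite: Volkov2020, Appendix «𝒫[F₂₃] = 16m², 𝒫[F₂₄] = −8m², 𝒫[F₃₄] = 0. Since 𝒫[F₂₃+F₂₄+F₃₄] = 8m² ≠ 0 …» (journal p.19; tex l.676–678)] -/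
theorem dominant_over_majorant_printed (hΛ : 1 ≤ Λ) {m : ℝ} (hm : m ≠ 0) :
    Tendsto (fun δ => dominantSum Λ m (16 * m ^ 2) (-(8 * m ^ 2)) 0 δ /
        (Real.sqrt (Finset.univ.inf' ⟨0, Finset.mem_univ _⟩ (ray Λ δ)) / ∏ i, ray Λ δ i))
      (𝓝[>] 0) (𝓝 (-(8 * Λ ^ 2 / ((Λ + 3) ^ 2 * (Λ ^ 3 + 3 * Λ ^ 2 + 9))))) ∧
    -(8 * Λ ^ 2 / ((Λ + 3) ^ 2 * (Λ ^ 3 + 3 * Λ ^ 2 + 9))) ≠ 0 := by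
  have hΛ0 : 0 < Λ := by linarith
  have h := dominant_over_majorant_tendsto hΛ hm (16 * m ^ 2) (-(8 * m ^ 2)) 0
  have hm2 : m ^ 2 ≠ 0 := by positivity
  have e : (16 * m ^ 2 + -(8 * m ^ 2) + 0) * Λ ^ 2 * pairLimit Λ m = -(8 * Λ ^ 2 / ((Λ + 3) ^ 2 * (Λ ^ 3 + 3 * Λ ^ 2 + 9))) := by
    unfold pairLimit
    field_simp
    ring
  rw [e] at h
  refine ⟨h, neg_ne_zero.2 (div_ne_zero (by positivity) (by positivity))⟩

end Ray

end AppendixExample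

end Literature.MathematicalPhysics.QuantumFieldTheory.Volkov2020
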